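import Literature.AnabelianGeometry.SemiGraphs.SpecialFibreDecompSubgroupsCuspOmission
import HarnessLib

/-!
# The Cor-3.9-DERIVED graph action `Π → Aut 𝔾` on the cusp-omitted special fibre — "the natural action of
# `G_k` on `𝔾`" ([IUTchI] §2 p. 47) CONSTRUCTED from [SemiAnbd] Cor. 3.9, not posited — DEFINITIONS

Mochizuki, *Semi-graphs of anabelioids*, Publ. RIMS **42** (2006), Cor. 3.9 pp. 42–43 (graphicity: a quasi-geometric
isomorphism of tempered fundamental groups "arises from a [unique] locally open morphism of graphs of anabelioids"),
Ex. 3.10 p. 44 ("semi-graphs of anabelioids `𝒢_i`, `𝒢^c_i` on which `Δ_i` acts"), Cor. 3.11 proof p. 46 ("in a fashion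
that is functorial with respect to `γ`") [cite: MochizukiSemiAnbd2006, Cor 3.9 pp.42-43]; Mochizuki, *Inter-universal
Teichmüller theory I*, §2 p. 47 l. 22–24 ("stabilized by the natural action of `G_k` on `𝔾`"), Cor. 2.3 (i) p. 47
[cite: Mochizuki2012, IUTchI Cor 2.3(i) p.47] [claim: Mochizuki2012, status: disputed] (nothing of the IUT series is
asserted here).

abc-iut cell, layer L3, seat abc-iut-L3-d1 gen 12, in-lineage sequel «DERIVED-ACTGRAPH@SPECIAL-FIBRE» (L3-lead δ6 (2)
GO) of the row «AUTOFCONJ-INDUCES-UPTOTWIST + HHSTAB-DERIVED@FINITE-SPECIAL-FIBRE»: the capstone of the F-1710 instance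
programme at the special fibre — gen 11's A1 existence / A2 uniqueness / A4 multiplicativity / A5 `Δ`-triviality
(`SpecialFibreConjugationGraphic.lean`) ASSEMBLED into ONE homomorphism.  DEFINITIONS (review lane) + the definitional
laws needed to build them; no instance, no notation, no `Prop` fact.  The theorems about the action (vertex part =
`actVertex`, `Δ` acts trivially, `hHstab` from node-stability, agreement with a `PiData` record on vertices) are the
proof-only companion `SpecialFibreDerivedGraphActionProofs.lean`.

* `SpecialFibreData.derivedHom hK0 g : Hom 𝒢 𝒢` — a CHOSEN Cor-3.9 isomorphism of the cusp-omitted FINITE special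
  fibre `𝒢 = S.graph` compatible with `autOfConj g` (A1); its underlying automorphism of `𝔾` does NOT depend on the
  choice (A2: `base_eq_derivedHom_base`);
* `SpecialFibreData.derivedAut hK0 g : Aut 𝔾` — that automorphism of the underlying semi-graph; `derivedAut_one`,
  `derivedAut_mul` (A5 at `δ = 1`, A4);
* ★ `SpecialFibreData.derivedActGraph hK0 : Π →* Aut 𝔾` — **a genuine HOMOMORPHISM**: the graph action of `Π` on the
  cusp-omitted special fibre DERIVED from the conjugation action on `π₁^temp(𝒢^c)`.

HONEST LIMITS.  `derivedActGraph` acts on the CUSP-OMITTED fibre `𝔾` (open edges are invisible to `π₁^temp`,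
Rmk. 3.9.1); extending it to `𝔾^c` is the Cor. 3.11 cusp step (`CuspMatching` / `CuspExtensionUnique` BY NAME, gen
11's B-section).  Cor. 3.9 at OUR finite carriers ≠ print's ∀; no side is taken on [IUTchIII] Cor. 3.12; nothing
here asserts that abc is proved or refuted.
-/

noncomputable section

namespace Literature.AnabelianGeometry.SemiGraphs

open CategoryTheory ProfiniteSemiGraph

universe u

namespace SpecialFibreData

variable {K : Type u} [Field K] {D : TemperedArithmeticGroup K} (S : SpecialFibreData D)
  [Finite S.Gc.graph.Vertex] [Finite S.Gc.graph.Edge]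
  (hK0 : (S.admissible.toMonoidHom.ker.map D.delta.subtype).Normal)

/-- **A chosen Cor-3.9 isomorphism `𝒢 ⥲ 𝒢` compatible with `autOfConj g`** (gen 11's A1
`exists_isIso_graphCompatible_autOfConj`; the choice is immaterial on underlying semi-graphs, A2).
[cite: MochizukiSemiAnbd2006, Cor 3.9 p.42] -/
def derivedHom (g : D.Pi) : Hom S.graph S.graph :=
  Classical.choose (S.exists_isIso_graphCompatible_autOfConj hK0 g)

/-- The chosen morphism is an isomorphism of semi-graphs of anabelioids. [cite: MochizukiSemiAnbd2006, Cor 3.9 p.42] -/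
theorem derivedHom_isIso (g : D.Pi) : (S.derivedHom hK0 g).IsIso :=
  (Classical.choose_spec (S.exists_isIso_graphCompatible_autOfConj hK0 g)).1

/-- The chosen morphism is compatible with `autOfConj g` on verticial and edge homomorphisms.
[cite: MochizukiSemiAnbd2006, Cor 3.9 p.42] -/
theorem derivedHom_graphCompatible (g : D.Pi) : S.GraphCompatible S (S.autOfConj hK0 g) (S.derivedHom hK0 g) :=
  (Classical.choose_spec (S.exists_isIso_graphCompatible_autOfConj hK0 g)).2

/-- **Independence of the choice** (Cor. 3.9 (b), uniqueness; A2): every locally open `F₀ : 𝒢 → 𝒢` compatible with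
`autOfConj g` has the underlying morphism of semi-graphs of `derivedHom g`. [cite: MochizukiSemiAnbd2006, Cor 3.9 p.43] -/
theorem base_eq_derivedHom_base (g : D.Pi) {F₀ : Hom S.graph S.graph} (hF₀ : F₀.IsLocallyOpen)
    (h : S.GraphCompatible S (S.autOfConj hK0 g) F₀) : F₀.base = (S.derivedHom hK0 g).base :=
  S.graphCompatible_autOfConj_base_unique hK0 g hF₀ (S.derivedHom_isIso hK0 g).isLocallyTrivial.isLocallyOpen h
    (S.derivedHom_graphCompatible hK0 g)

/-- **The derived automorphism of the underlying semi-graph `𝔾`** of the cusp-omitted special fibre attached to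
`g ∈ Π`. [cite: MochizukiSemiAnbd2006, Cor 3.9 p.42] -/
def derivedAut (g : D.Pi) : Aut S.graph.graph :=
  haveI := (S.derivedHom_isIso hK0 g).isIso_base
  asIso ((S.derivedHom hK0 g).base : S.graph.graph ⟶ S.graph.graph)

/-- `(derivedAut g).hom` is the underlying morphism of `derivedHom g` (definitional bookkeeping).
[cite: MochizukiSemiAnbd2006, Cor 3.9 p.42] -/
@[simp] theorem derivedAut_hom (g : D.Pi) :
    (S.derivedAut hK0 g).hom = ((S.derivedHom hK0 g).base : S.graph.graph ⟶ S.graph.graph) := rfl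

/-- **Unit**: `derivedAut 1 = 1` (`autOfConj 1` is compatible with the identity of `𝒢`, A5a at `δ = 1`; uniqueness A2).
[cite: MochizukiSemiAnbd2006, Cor 3.9 p.43] -/
theorem derivedAut_one : S.derivedAut hK0 1 = 1 := by
  ext : 1
  rw [derivedAut_hom]
  exact S.graphCompatible_autOfConj_base_eq_id_of_mem_delta hK0 1
    (S.derivedHom_isIso hK0 1).isLocallyTrivial.isLocallyOpen (S.derivedHom_graphCompatible hK0 1)

/-- **Multiplicativity**: `derivedAut (g h) = derivedAut g * derivedAut h` (functoriality of Cor. 3.9, A4: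
the base for `autOfConj (g h) = autOfConj g ∘ autOfConj h` is the composite of the bases).
[cite: MochizukiSemiAnbd2006, Cor 3.9 pp.42-43] -/
theorem derivedAut_mul (g h : D.Pi) : S.derivedAut hK0 (g * h) = S.derivedAut hK0 g * S.derivedAut hK0 h := by
  ext : 1
  rw [Aut.Aut_mul_def, Iso.trans_hom, derivedAut_hom, derivedAut_hom, derivedAut_hom]
  exact S.graphCompatible_autOfConj_base_mul hK0 g h
    (S.derivedHom_isIso hK0 g).isLocallyTrivial.isLocallyOpen (S.derivedHom_isIso hK0 h).isLocallyTrivial.isLocallyOpen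
    (S.derivedHom_isIso hK0 (g * h)).isLocallyTrivial.isLocallyOpen (S.derivedHom_graphCompatible hK0 g)
    (S.derivedHom_graphCompatible hK0 h) (S.derivedHom_graphCompatible hK0 (g * h))

/-- ★ **The DERIVED graph action `Π → Aut 𝔾` on the cusp-omitted special fibre** — a homomorphism ([SemiAnbd] Cor.
3.11 "functorial with respect to `γ`"; [IUTchI] p. 47 "the natural action … on `𝔾`"), CONSTRUCTED from the conjugation
action on `π₁^temp(𝒢^c)` via Cor. 3.9. [cite: Mochizuki2012, IUTchI Cor 2.3(i) p.47] -/
def derivedActGraph : D.Pi →* Aut S.graph.graph where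
  toFun := S.derivedAut hK0
  map_one' := S.derivedAut_one hK0
  map_mul' := S.derivedAut_mul hK0

/-- `derivedActGraph g = derivedAut g` (definitional). [cite: Mochizuki2012, IUTchI Cor 2.3(i) p.47] -/
@[simp] theorem derivedActGraph_apply (g : D.Pi) : S.derivedActGraph hK0 g = S.derivedAut hK0 g := rfl

end SpecialFibreData

end Literature.AnabelianGeometry.SemiGraphs

end
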